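/-
Copyright (c) 2026 the pub-hodgecm-mathlib formalisation cell (harness21).  Prover seat hodgecm-mathlib-F0P3a-p01 (g15), 2026-09-01.  Road «S3-ram» (LEAD F0P3a-plan (g12)
T11-50 (2) ∕ T11-52 (2) ∕ T11-58 (2); owner F0P3a-p06 (g15)): organ (e3) «LEVI-ram CLAUSE» modulo the C-Δram socket — ★ core p846879 + ★ (O2)-ram + ★ (O1).
-/
import Literature.NumberTheory.Rogawski1990.DepthZeroKappaTransferLeviCoreRamified    -- ★ p846879 (this seat): the ramified Levi CORE over sockets `hX` ∕ `hΔ`, `exists_continuousMulEquiv_level_of_frame`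
import Literature.NumberTheory.Automorphic.TorusDeepOrbitalIntegralStrataRamified      -- ★ (O2)-ram FILE 2 (p04 (g17)): `classOrbitalIntegral_eq_mul_rankStrata_of_torus_deep_of_ramified`; ⊇ ★ FILE 1 p846874 (p07 (g12))
import Literature.NumberTheory.Rogawski1990.LeviNearOneDeep                             -- ★ p846586 (O1): `exists_nhds_one_forall_levi_deep` (place-generic)
import HarnessLib

/-!
# The LEVI ROW of the depth-zero Δ‴-transfer at a TAME-RAMIFIED non-split place for a level-1 `K`-class piece, modulo the C-Δram Levi value
# (Rogawski (1990) §4.9 Prop. 4.9.1, §4.3 (4.3.1))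

Topic `NumberTheory/Rogawski1990`; namespace `Literature.NumberTheory.Rogawski1990`.  KERNEL mathematics only: theorems, no definition, no named fact, no
instance, no notation, no `sorry`.  Cell `pub/hodgecm-mathlib`, crux H413 = `stmt-HodgeConjecture-24833`; road «S3-ram» (Literature seeding; LEAD F0P3a-plan (g12),
owner F0P3a-p06 (g15)), organ **(e3) «LEVI-ram CLAUSE»** ((e3)-second F0P3a-p01 (g15); holder p07 (g12)).  This file plugs the (O2)-ram socket `hX` of the ★ core
p846879 `finsum_delta_mul_classOrbitalIntegral_eq_of_levi_ramified_of_orbital_eq` with ★ `classOrbitalIntegral_eq_mul_rankStrata_of_torus_deep_of_ramified` (p04 (g17) over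
p07's ★ `HeisenbergStrataMeasureRamified`) and its depth socket with ★ (O1) `exists_nhds_one_forall_levi_deep`, leaving ONLY the C-Δram Levi value `hΔ` (F0P3b-p01 (g12):
near `1`, `Δ‴_v(yγ_Hy⁻¹, γ₀) = ε·‖a − 1‖`) as a hypothesis.  CONSUMER: the Levi population of END's `stub_rowsRam` ∕ the `_le_one`-ram waypoint (END F0P3a-p03 (g16)).
HONEST LABEL: HC_CM is proved only modulo the cell's 2 remaining named inputs (hLiu418 24832, h413 24833) until rung 0 closes; «S3-ram» has no books consequence; this
file is unconditional and discharges nothing by itself.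

THE STATEMENT.  At a tame-ramified non-split `v ∤ 2` with good, integrally-antidiagonal frame (`hframe`), canonical families: for a level-1 `K′`-class piece `g`
(`C_c^∞`, `tsupport g ⊆ K′`, `Ad K′`-invariant, `g = c r` on the residual-rank-`r` unipotent stratum of `K′`) and the C-Δram Levi value `ε`, the two-row identity
`Σᶠ_c Δ‴_v(γ_H, c)·Φ(c, g) = a₀·Φ^st(γ_H, χ₀) + a₁·Φ^st(γ_H, χ₁)` holds for `G`-regular LEVI `γ_H` near `1` whenever **`a₀·ν_H(K_H) = ε·ν_G(K′)·q⁻¹·(c₀ + (q − 1)c₂)`**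
— the tame-ramified Levi column (`S₁ = ∅`: the skew line lies in `𝔪_w`; ★ p846874) replacing the inert `q⁻³·(c₀ + (q − 1)c₁ + (q³ − q)c₂)`.

## References
* [Rogawski1990] J. D. Rogawski, *Automorphic Representations of Unitary Groups in Three Variables*, Ann. of Math. Stud. 123 (1990), §4.9 Prop. 4.9.1 (a)(b), (4.9.2) pp. 54–56;
  §4.3 (4.3.1) p. 43.
* [LanglandsShelstad1987] R. P. Langlands, D. Shelstad, *On the definition of transfer factors*, Math. Ann. 278 (1987), §1.3–1.4.
* [Kottwitz1986] R. E. Kottwitz, *Base change for unit elements of Hecke algebras*, Compositio Math. 60 (1986), §3, §7.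
* [Flicker1998UnitaryFL] Y. Z. Flicker, *Elementary proof of a fundamental lemma for a unitary group*, Canad. J. Math. 50 (1998), §2.
-/

set_option autoImplicit false

noncomputable section

open NumberField IsDedekindDomain MeasureTheory Measure Topology Filter Matrix
open Literature.NumberTheory.Automorphic Literature.NumberTheory.Automorphic.UnitaryGroup Literature.NumberTheory.Automorphic.IntegralReduction
open Literature.NumberTheory.GaloisRepresentations
open scoped Matrix MatrixGroups NNReal ENNReal ValuativeRel

namespace Literature.NumberTheory.Rogawski1990

set_option maxHeartbeats 1600000 in
-- instance-term unification on the CM local carriers (as in ★ p846879)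
open scoped Classical in
/-- **THE LEVI ROW OF THE Δ‴-TRANSFER AT A TAME-RAMIFIED PLACE FOR A LEVEL-1 `K`-CLASS PIECE, MODULO THE C-Δram LEVI VALUE** (organ (e3)): ★ core p846879
with `hX :=` ★ `classOrbitalIntegral_eq_mul_rankStrata_of_torus_deep_of_ramified` (`X = q⁻¹·(c₀·1 + c₁·0 + c₂·(q − 1))`) and `deep :=` 1-deep (★ (O1)
`exists_nhds_one_forall_levi_deep`); the remaining hypothesis `hΔ` is the C-Δram Levi value near `1`, `Δ‴_v(yγ_Hy⁻¹, γ₀) = ε·‖d₀⁻¹d₁ − 1‖`; test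
`ha : a₀·ν_H(K_H) = ε·ν_G(K′)·X`, `a₁` free. [cite: Rogawski1990, §4.9 Prop. 4.9.1 (a)(b) pp. 54–56; §4.3 (4.3.1) p. 43] [cite: LanglandsShelstad1987, §1.3–1.4]
[cite: Kottwitz1986, §3] [cite: Flicker1998UnitaryFL, §2] -/
theorem finsum_delta_mul_classOrbitalIntegral_eq_of_levi_ramified_of_delta_eq
    (L : Type) [Field L] [NumberField L] [IsCMField L] (H' : Matrix (Fin 3) (Fin 3) L) (μ : HeckeCharacter L)
    {v : HeightOneSpectrum (𝓞 ↥(maximalRealSubfield L))}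
    (hH' : (H'.map (cmConjRingHom L)).transpose = H') (w : PlacesOver L v)
    (hw : IsCMField.complexConj L • w.1 = w.1) (he : v.asIdeal.ramificationIdx' w.1.asIdeal ≠ 1)
    -- good reduction (`_hH'i` idle: the frame binder `hframe`∕`hA` below carries the integrality; kept so the binder list is END's socket frame)
    (hH'w : IsUnit (placeForm H' w.1)) (_hH'i : hH'w.unit ∈ glInt 3 (w.1.adicCompletion L))
    (h2 : IsUnit (2 : 𝒪[w.1.adicCompletion L]))
    -- the integral antidiagonal FRAME of `H′_w` (END fold v2 socket binders; supplied at a tame-ramified `w` by ★ p846344 `exists_glInt_placeForm_eq_smul_formCongr_antidiagonal_of_neg`)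
    (A : GL (Fin 3) (w.1.adicCompletion L)) (hA : A ∈ glInt 3 (w.1.adicCompletion L))
    (hframe : placeForm H' w.1 = (-(placeForm H' w.1).det) • formCongr (galAdicCompletionMap (L := L) (IsCMField.complexConj L) hw) A ((StdForm.antidiagonal 3).over (w.1.adicCompletion L)))
    [MeasurableSpace ((cmDatum L 3 H').Local v)] [BorelSpace ((cmDatum L 3 H').Local v)]
    [∀ γ : ((cmDatum L 3 H').Local v), MeasurableSpace (((cmDatum L 3 H').Local v) ⧸ Subgroup.centralizer ({γ} : Set ((cmDatum L 3 H').Local v)))]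
    [∀ γ : ((cmDatum L 3 H').Local v), BorelSpace (((cmDatum L 3 H').Local v) ⧸ Subgroup.centralizer ({γ} : Set ((cmDatum L 3 H').Local v)))]
    [MeasurableSpace ((cmDatum L 2 (Matrix.of fun i j : Fin 2 => if i.val + j.val + 1 = 2 then (1 : L) else 0)).Local v ×
      (cmDatum L 1 (Matrix.of fun i j : Fin 1 => if i.val + j.val + 1 = 1 then (1 : L) else 0)).Local v)]
    [BorelSpace ((cmDatum L 2 (Matrix.of fun i j : Fin 2 => if i.val + j.val + 1 = 2 then (1 : L) else 0)).Local v ×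
      (cmDatum L 1 (Matrix.of fun i j : Fin 1 => if i.val + j.val + 1 = 1 then (1 : L) else 0)).Local v)]
    [∀ a : ((cmDatum L 2 (Matrix.of fun i j : Fin 2 => if i.val + j.val + 1 = 2 then (1 : L) else 0)).Local v ×
      (cmDatum L 1 (Matrix.of fun i j : Fin 1 => if i.val + j.val + 1 = 1 then (1 : L) else 0)).Local v),
      MeasurableSpace (((cmDatum L 2 (Matrix.of fun i j : Fin 2 => if i.val + j.val + 1 = 2 then (1 : L) else 0)).Local v ×
      (cmDatum L 1 (Matrix.of fun i j : Fin 1 => if i.val + j.val + 1 = 1 then (1 : L) else 0)).Local v) ⧸ Subgroup.centralizer ({a} : Set ((cmDatum L 2 (Matrix.of fun i j : Fin 2 => if i.val + j.val + 1 = 2 then (1 : L) else 0)).Local v ×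
      (cmDatum L 1 (Matrix.of fun i j : Fin 1 => if i.val + j.val + 1 = 1 then (1 : L) else 0)).Local v)))]
    [∀ a : ((cmDatum L 2 (Matrix.of fun i j : Fin 2 => if i.val + j.val + 1 = 2 then (1 : L) else 0)).Local v ×
      (cmDatum L 1 (Matrix.of fun i j : Fin 1 => if i.val + j.val + 1 = 1 then (1 : L) else 0)).Local v),
      BorelSpace (((cmDatum L 2 (Matrix.of fun i j : Fin 2 => if i.val + j.val + 1 = 2 then (1 : L) else 0)).Local v ×
      (cmDatum L 1 (Matrix.of fun i j : Fin 1 => if i.val + j.val + 1 = 1 then (1 : L) else 0)).Local v) ⧸ Subgroup.centralizer ({a} : Set ((cmDatum L 2 (Matrix.of fun i j : Fin 2 => if i.val + j.val + 1 = 2 then (1 : L) else 0)).Local v ×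
      (cmDatum L 1 (Matrix.of fun i j : Fin 1 => if i.val + j.val + 1 = 1 then (1 : L) else 0)).Local v)))]
    (νH : Measure ((cmDatum L 2 (Matrix.of fun i j : Fin 2 => if i.val + j.val + 1 = 2 then (1 : L) else 0)).Local v ×
      (cmDatum L 1 (Matrix.of fun i j : Fin 1 => if i.val + j.val + 1 = 1 then (1 : L) else 0)).Local v)) [νH.IsHaarMeasure] [νH.IsMulRightInvariant]
    (νG : Measure ((cmDatum L 3 H').Local v)) [νG.IsHaarMeasure] [νG.IsMulRightInvariant]
    {mH : OrbitalMeasureFamily ((cmDatum L 2 (Matrix.of fun i j : Fin 2 => if i.val + j.val + 1 = 2 then (1 : L) else 0)).Local v ×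
      (cmDatum L 1 (Matrix.of fun i j : Fin 1 => if i.val + j.val + 1 = 1 then (1 : L) else 0)).Local v)} {mG : OrbitalMeasureFamily ((cmDatum L 3 H').Local v)}
    (hmH : mH.IsCanonical (IsLocalGRegular L v) νH)
    (hmG : mG.IsCanonical (fun γ => IsRegularElt (γ.val : GL (Fin 3) (UnitaryGroup.LocalRing L v))) νG)
    -- the depth-zero piece: `C_c^∞`, supported in `K′`, `Ad K′`-invariant, constant `c r` on the residual-rank-`r` unipotent stratum (★ p846693's binders VERBATIM)
    (g : ((cmDatum L 3 H').Local v) → ℂ) (hg : IsLocSmooth g) (hgK : tsupport g ⊆ (cmLocalIntegralLevel L 3 H' v : Set ((cmDatum L 3 H').Local v)))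
    (hginv : ∀ u ∈ cmLocalIntegralLevel L 3 H' v, ∀ x, g (u * x * u⁻¹) = g x)
    (c : ℕ → ℂ)
    (hc : ∀ k ∈ cmLocalIntegralLevel L 3 H' v,
      (redMat (((k.val : GL (Fin 3) (UnitaryGroup.LocalRing L v)).val.map (Pi.evalRingHom (fun w' : PlacesOver L v => w'.1.adicCompletion L) w))) - 1) ^ 3 = 0 →
      g k = c (redMat (((k.val : GL (Fin 3) (UnitaryGroup.LocalRing L v)).val.map (Pi.evalRingHom (fun w' : PlacesOver L v => w'.1.adicCompletion L) w))) - 1).rank)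
    (a₀ a₁ ε : ℂ)
    -- SOCKET C-Δram: the LEVI VALUE of Rogawski's explicit factor near `1`, `Δ‴_v(γ₁, γ₀) = ε·‖a − 1‖` (binders = ★ T5-Levi `finExplicitDelta_eq_unitModulusChar_of_levi_of_nonsplit`'s)
    (hΔ : ∃ VΔ ∈ 𝓝 (1 : ((cmDatum L 2 (Matrix.of fun i j : Fin 2 => if i.val + j.val + 1 = 2 then (1 : L) else 0)).Local v ×
        (cmDatum L 1 (Matrix.of fun i j : Fin 1 => if i.val + j.val + 1 = 1 then (1 : L) else 0)).Local v)),
      ∀ γH ∈ VΔ, ∀ (y : ((cmDatum L 2 (Matrix.of fun i j : Fin 2 => if i.val + j.val + 1 = 2 then (1 : L) else 0)).Local v ×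
        (cmDatum L 1 (Matrix.of fun i j : Fin 1 => if i.val + j.val + 1 = 1 then (1 : L) else 0)).Local v)) (d : Fin 3 → (UnitaryGroup.LocalRing L v)ˣ),
        ((endoEmbLocal L v (y * γH * y⁻¹)).val : GL (Fin 3) (UnitaryGroup.LocalRing L v)) = glDiagonal 3 (UnitaryGroup.LocalRing L v) d →
        (∀ i j, i ≠ j → IsUnit ((d i : UnitaryGroup.LocalRing L v) - d j)) →
        endoEmbLocal L v (y * γH * y⁻¹) ∈ cmLocalIntegralLevel L 3 (Matrix.of fun i j : Fin 3 => if i.val + j.val + 1 = 3 then (1 : L) else 0) v →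
        ∀ (ha : IsUnit ((((d 0)⁻¹ * d 1 : (UnitaryGroup.LocalRing L v)ˣ) : UnitaryGroup.LocalRing L v) - 1)) (γ₀ : (cmDatum L 3 H').Local v),
          IsLocalNormPair L H' v (y * γH * y⁻¹) γ₀ →
          finExplicitDelta L v H' (y * γH * y⁻¹) μ γ₀ = ε * (((unitModulusChar (UnitaryGroup.LocalRing L v) ha.unit : ℝ≥0) : ℝ) : ℂ))
    -- the coefficient test with the TAME-RAMIFIED Levi column `X = q⁻¹·(c₀ + (q − 1)c₂)` of ★ (O2)-ram (`a₁` free: the `χ₁`-row vanishes, ★ p846841)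
    (ha : a₀ * (νH.real (((cmLocalIntegralLevel L 2 (Matrix.of fun i j : Fin 2 => if i.val + j.val + 1 = 2 then (1 : L) else 0) v).prod
                (cmLocalIntegralLevel L 1 (Matrix.of fun i j : Fin 1 => if i.val + j.val + 1 = 1 then (1 : L) else 0) v) : Subgroup _) : Set _) : ℂ) =
      ε * (νG.real (cmLocalIntegralLevel L 3 H' v : Set ((cmDatum L 3 H').Local v)) : ℂ) *
        ((Ideal.absNorm v.asIdeal : ℂ)⁻¹ * (c 0 * 1 + c 1 * 0 + c 2 * ((Ideal.absNorm v.asIdeal : ℂ) - 1)))) :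
        ∃ V ∈ 𝓝 (1 : ((cmDatum L 2 (Matrix.of fun i j : Fin 2 => if i.val + j.val + 1 = 2 then (1 : L) else 0)).Local v ×
        (cmDatum L 1 (Matrix.of fun i j : Fin 1 => if i.val + j.val + 1 = 1 then (1 : L) else 0)).Local v)),
      ∀ γH ∈ V, IsLocalGRegular L v γH →
        (∃ (y : ((cmDatum L 2 (Matrix.of fun i j : Fin 2 => if i.val + j.val + 1 = 2 then (1 : L) else 0)).Local v ×
        (cmDatum L 1 (Matrix.of fun i j : Fin 1 => if i.val + j.val + 1 = 1 then (1 : L) else 0)).Local v)) (d' : Fin 2 → (UnitaryGroup.LocalRing L v)ˣ),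
          glDiagonal 2 (UnitaryGroup.LocalRing L v) d' = ((y * γH * y⁻¹).1.val : GL (Fin 2) (UnitaryGroup.LocalRing L v))) →
        ∑ᶠ cG : ConjClasses ((cmDatum L 3 H').Local v),
            ((finExplicitCollection L H' μ (finExplicitDelta_conj_left_all L H' μ) (finExplicitDelta_conj_right_all L H' μ)) v).Δ γH (Quotient.out cG) *
              classOrbitalIntegral mG g cG =
          a₀ * stableOrbitalIntegralRel (IsLocalStablyConjH L v) mH
                ((((cmLocalIntegralLevel L 2 (Matrix.of fun i j : Fin 2 => if i.val + j.val + 1 = 2 then (1 : L) else 0) v).prod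
                (cmLocalIntegralLevel L 1 (Matrix.of fun i j : Fin 1 => if i.val + j.val + 1 = 1 then (1 : L) else 0) v) : Subgroup _) : Set _).indicator
              (fun h => if (redMat (((h.1.val : GL (Fin 2) (UnitaryGroup.LocalRing L v)).val.map (Pi.evalRingHom (fun w' : PlacesOver L v => w'.1.adicCompletion L) w))) - 1) ^ 2 = 0 ∧ (redMat (((h.1.val : GL (Fin 2) (UnitaryGroup.LocalRing L v)).val.map (Pi.evalRingHom (fun w' : PlacesOver L v => w'.1.adicCompletion L) w))) - 1).rank = 0 then (1 : ℂ) else 0)) γH +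
          a₁ * stableOrbitalIntegralRel (IsLocalStablyConjH L v) mH
                ((((cmLocalIntegralLevel L 2 (Matrix.of fun i j : Fin 2 => if i.val + j.val + 1 = 2 then (1 : L) else 0) v).prod
                (cmLocalIntegralLevel L 1 (Matrix.of fun i j : Fin 1 => if i.val + j.val + 1 = 1 then (1 : L) else 0) v) : Subgroup _) : Set _).indicator
              (fun h => if (redMat (((h.1.val : GL (Fin 2) (UnitaryGroup.LocalRing L v)).val.map (Pi.evalRingHom (fun w' : PlacesOver L v => w'.1.adicCompletion L) w))) - 1) ^ 2 = 0 ∧ (redMat (((h.1.val : GL (Fin 2) (UnitaryGroup.LocalRing L v)).val.map (Pi.evalRingHom (fun w' : PlacesOver L v => w'.1.adicCompletion L) w))) - 1).rank = 1 then (1 : ℂ) else 0)) γH := by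
  have hH'c : (H'.map (IsCMField.complexConj L))ᵀ = H' := hH'
  have hH'd : IsUnit H'.det := by
    have h := (Matrix.isUnit_iff_isUnit_det _).1 hH'w
    rw [show placeForm H' w.1 = (algebraMap L (w.1.adicCompletion L)).mapMatrix H' from rfl, ← RingHom.map_det] at h
    exact isUnit_iff_ne_zero.2 fun h0 => h.ne_zero (by rw [h0, map_zero])
  have h2w : Valued.v (2 : w.1.adicCompletion L) = 1 := (isUnit_two_integer_iff_valued_eq_one L w.1).1 h2
  exact finsum_delta_mul_classOrbitalIntegral_eq_of_levi_ramified_of_orbital_eq L H' μ hH' w hw he hH'w _hH'i h2 A hA hframe νH νG hmH hmG g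
    (fun d => ∀ k : Fin 3, Valued.v ((((d k : (UnitaryGroup.LocalRing L v)ˣ) : UnitaryGroup.LocalRing L v) w) - 1) < 1)
    (exists_nhds_one_forall_levi_deep L v w) (fun _ hd => hd) _ a₀ a₁ ε
    (by
      intro _ _ ψ hψK hψc T hT hψT μN _ t d hd hreg ha' hb' hdp γ₀ hγ₀
      exact classOrbitalIntegral_eq_mul_rankStrata_of_torus_deep_of_ramified L w hw H' hH'c hH'd he h2w νG hmG ψ hψK hψc T hT hψT t hd hreg ha' hb' hdp hγ₀
        g hg hgK hginv c hc)
    hΔ ha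

end Literature.NumberTheory.Rogawski1990

end
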